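import Mathlib
import HarnessLib
import Literature.AlgebraicGeometry.Resolution.LipmanProcedure
import Literature.AlgebraicGeometry.Resolution.Blowups
import Literature.AlgebraicGeometry.Resolution.BlowupsFlatBaseChange
import Literature.AlgebraicGeometry.Resolution.MarkedIdealsEtale
import Literature.AlgebraicGeometry.CossartJannsenSaito2020.BlowupTowerLocalize
import Literature.AlgebraicGeometry.Resolution.ComponentGluing
import Literature.AlgebraicGeometry.Resolution.ReducedSubschemes
import Literature.AlgebraicGeometry.Resolution.ReducedOfSmoothOverReduced

/-!
# The reduced singular locus and its blowing-up restrict along open immersions (and along flat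
# preimmersions; the étale statement)
(crux stmt-ResolutionOfSingularities-15640 `WildQuotients.WildQuotientResolution`, line `Sketch`;
chain w45c, next-rung infrastructure, res-L1-w45c-plan-1 NAMING 10:11:57Z «(γ2)
`BlowupExit.singRed_restrict`» to res-D-pv-033 AS res-L1-w45c-stub-5; the kernel form of
res-L1-w45c-idea-2's RT-LADDER §2/§6 (e) «canonical centre ⇒ the pieces at the different vertices
need no compatibility: `Bl_{Sing_red}` restricted to a chart is `Bl_{Sing_red}` of the chart».
[OURS · L1 W4.5c] — generic scheme theory assembled from tree lemmas, NOT a statement of any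
manuscript; replaces the role of no printed item.)

VOCABULARY (all in the tree): `Scheme.regularLocus X` (`Resolution/QuasiExcellentSchemes`);
for `f : X ⟶ Spec k` locally of finite type, `singularLocusClosed X f : Closeds X` (`= (Reg X)ᶜ`,
closed by `isOpen_regularLocus_of_locallyOfFiniteType_field`) and
`singularLocusIdeal X f := vanishingIdeal (singularLocusClosed X f)` — the singular locus «with its
reduced structure» (`Resolution/LipmanProcedure`, Liu §8.3.4); `IsBlowup` (GW Def. 13.90).

CONTENTS.
* `preimage_regularLocus_of_flat_of_isPreimmersion` — `g⁻¹(Reg X) = Reg V` for a flat preimmersion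
  `g : V ⟶ X` (open immersions, `Spec 𝒪_{X,x} → X`, …): stalk maps are isomorphisms
  (tree `mem_regularLocus_iff_of_flat_of_isPreimmersion`).
* `singularLocusClosed_preimage`, `singularLocusIdeal_comap` — **`Sing(X) ∩ V = Sing(V)` and
  `𝓘_{Sing X} · 𝒪_V = 𝓘_{Sing V}`** for a flat preimmersion (the second by CJS-kit
  `comap_vanishingIdeal_eq_of_flat_of_isPreimmersion`: reduced centres pull back to reduced centres).
* `isBlowup_morphismRestrict_singularLocusIdeal` — **`Bl_{Sing X}(X)|_U = Bl_{Sing U}(U)`**: if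
  `π : X' ⟶ X` is a blowing-up of the reduced singular locus then `π ∣_ U` is a blowing-up of the
  reduced singular locus of `U` (tree `IsBlowup.restrict`); `isBlowup_pullback_snd_singularLocusIdeal`
  — the same for the base change along any flat preimmersion (tree `IsBlowup.pullback_snd_of_flat`).
* Étale morphisms: `preimage_regularLocus_of_etale`, `singularLocusClosed_preimage_of_etale`
  (Matsumura 23.7, tree `isRegularLocalRing_stalk_iff_of_etale`; stated for flat + unramified +
  locally of finite type), `radical_comap_singularLocusIdeal_of_etale` (the pulled-back centre has
  radical `𝓘_{Sing V}`), and for `[Etale g]` the EQUALITY **`singularLocusIdeal_comap_of_etale` —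
  `𝓘_{Sing X} · 𝒪_V = 𝓘_{Sing V}`** (the pulled-back reduced centre is reduced: `V(𝓘) ×_X V → V(𝓘)`
  is étale, hence smooth, over the reduced locally Noetherian `V(𝓘)`, tree
  `isReduced_of_smooth_of_isReduced_base`, Stacks 034E/025P) with
  **`isBlowup_pullback_snd_singularLocusIdeal_of_etale` — `Bl_{Sing X}(X) ×_X V = Bl_{Sing V}(V)`**
  (blow-ups commute with flat base change, GW 13.91 (2)): the étale-chart form of «no gluing».
-/

-- single-problem summit: the doubled namespace component `ResolutionOfSingularities` is forced
set_option linter.dupNamespace false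

noncomputable section

open CategoryTheory CategoryTheory.Limits AlgebraicGeometry TopologicalSpace
open AlgebraicGeometry.Scheme.IdealSheafData
open Literature.AlgebraicGeometry.Resolution Literature.AlgebraicGeometry.CossartJannsenSaito2020

namespace Summit.ResolutionOfSingularities.ResolutionOfSingularities.Theorems.WildQuotientResolution.BlowupExit

universe u

variable {k : Type u} [Field k]

/-! ## Flat preimmersions (open immersions, local schemes) -/

/-- **`g⁻¹(Reg X) = Reg V`** for a flat preimmersion `g : V ⟶ X`. [folklore] -/
theorem preimage_regularLocus_of_flat_of_isPreimmersion {V X : Scheme.{u}} (g : V ⟶ X) [Flat g]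
    [IsPreimmersion g] : g ⁻¹' Scheme.regularLocus X = Scheme.regularLocus V := by
  ext v
  exact (mem_regularLocus_iff_of_flat_of_isPreimmersion g v).symm

/-- **`Sing(X) ∩ V = Sing(V)`** (as closed subsets): the reduced singular locus of `X` pulls back,
along a flat preimmersion `g : V ⟶ X` (e.g. the inclusion of an open), to the reduced singular
locus of `V`. [folklore] -/
theorem singularLocusClosed_preimage {V X : Scheme.{u}} (f : X ⟶ Spec (.of k))
    [LocallyOfFiniteType f] (g : V ⟶ X) [Flat g] [IsPreimmersion g]
    [LocallyOfFiniteType (g ≫ f)] :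
    (singularLocusClosed X f).preimage g.continuous = singularLocusClosed V (g ≫ f) := by
  ext v
  rw [Closeds.coe_preimage, coe_singularLocusClosed, coe_singularLocusClosed, Set.preimage_compl,
    preimage_regularLocus_of_flat_of_isPreimmersion]

/-- **`𝓘_{Sing X} · 𝒪_V = 𝓘_{Sing V}`**: the ideal sheaf of the reduced singular locus pulls back,
along a flat preimmersion `g : V ⟶ X`, to the ideal sheaf of the reduced singular locus of `V`
(reduced centres pull back to reduced centres, GW Prop. 13.91 (2) / CJS p. 107). [folklore] -/
theorem singularLocusIdeal_comap {V X : Scheme.{u}} (f : X ⟶ Spec (.of k))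
    [LocallyOfFiniteType f] (g : V ⟶ X) [Flat g] [IsPreimmersion g]
    [LocallyOfFiniteType (g ≫ f)] :
    (singularLocusIdeal X f).comap g = singularLocusIdeal V (g ≫ f) := by
  rw [singularLocusIdeal, comap_vanishingIdeal_eq_of_flat_of_isPreimmersion,
    singularLocusClosed_preimage, singularLocusIdeal]

/-- **`Bl_{Sing X}(X)|_U = Bl_{Sing U}(U)`**: a blowing-up of the reduced singular locus restricts,
over an open `U ⊆ X`, to a blowing-up of the reduced singular locus of `U` — the canonical centre
needs no gluing data (RT-LADDER §2/§6 (e)). [folklore] -/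
theorem isBlowup_morphismRestrict_singularLocusIdeal {X' X : Scheme.{u}} (f : X ⟶ Spec (.of k))
    [LocallyOfFiniteType f] {π : X' ⟶ X} (hπ : IsBlowup π (singularLocusIdeal X f))
    (U : X.Opens) :
    IsBlowup (π ∣_ U) (singularLocusIdeal (U : Scheme.{u}) (U.ι ≫ f)) := by
  rw [← singularLocusIdeal_comap f U.ι]
  exact hπ.restrict U

/-- **`Bl_{Sing X}(X) ×_X V → V` is the blowing-up of `Sing(V)`** for the base change along any
flat preimmersion `g : V ⟶ X` (e.g. `Spec 𝒪_{X,x} → X`). [folklore] -/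
theorem isBlowup_pullback_snd_singularLocusIdeal {X' X V : Scheme.{u}} (f : X ⟶ Spec (.of k))
    [LocallyOfFiniteType f] {π : X' ⟶ X} (hπ : IsBlowup π (singularLocusIdeal X f))
    (g : V ⟶ X) [Flat g] [IsPreimmersion g] [LocallyOfFiniteType (g ≫ f)] :
    IsBlowup (pullback.snd π g) (singularLocusIdeal V (g ≫ f)) := by
  rw [← singularLocusIdeal_comap f g]
  exact hπ.pullback_snd_of_flat g

/-! ## Étale morphisms -/

/-- **`g⁻¹(Reg X) = Reg V`** for `g : V ⟶ X` flat, unramified and locally of finite type (étale)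
between locally Noetherian schemes (Matsumura Thm. 23.7). [folklore] -/
theorem preimage_regularLocus_of_etale {V X : Scheme.{u}} (g : V ⟶ X) [Flat g]
    [FormallyUnramified g] [LocallyOfFiniteType g] [IsLocallyNoetherian X]
    [IsLocallyNoetherian V] : g ⁻¹' Scheme.regularLocus X = Scheme.regularLocus V := by
  ext v
  simp only [Set.mem_preimage, Scheme.mem_regularLocus]
  exact (isRegularLocalRing_stalk_iff_of_etale g v).symm

/-- **`Sing(X) ×_X V = Sing(V)` as closed subsets** along an étale `g : V ⟶ X`. [folklore] -/
theorem singularLocusClosed_preimage_of_etale {V X : Scheme.{u}} (f : X ⟶ Spec (.of k))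
    [LocallyOfFiniteType f] (g : V ⟶ X) [Flat g] [FormallyUnramified g] [LocallyOfFiniteType g]
    [LocallyOfFiniteType (g ≫ f)] :
    (singularLocusClosed X f).preimage g.continuous = singularLocusClosed V (g ≫ f) := by
  haveI : IsLocallyNoetherian X := LocallyOfFiniteType.isLocallyNoetherian f
  haveI : IsLocallyNoetherian V := LocallyOfFiniteType.isLocallyNoetherian (g ≫ f)
  ext v
  rw [Closeds.coe_preimage, coe_singularLocusClosed, coe_singularLocusClosed, Set.preimage_compl,
    preimage_regularLocus_of_etale]

/-- **Along an étale `g : V ⟶ X` the pulled-back centre `𝓘_{Sing X} · 𝒪_V` has radical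
`𝓘_{Sing V}`** (its support is `g⁻¹ Sing(X) = Sing(V)`). [folklore] -/
theorem radical_comap_singularLocusIdeal_of_etale {V X : Scheme.{u}} (f : X ⟶ Spec (.of k))
    [LocallyOfFiniteType f] (g : V ⟶ X) [Flat g] [FormallyUnramified g] [LocallyOfFiniteType g]
    [LocallyOfFiniteType (g ≫ f)] :
    ((singularLocusIdeal X f).comap g).radical = singularLocusIdeal V (g ≫ f) := by
  rw [← vanishingIdeal_support, support_comap, singularLocusIdeal, singularLocusIdeal]
  congr 1
  rw [← singularLocusClosed_preimage_of_etale f g]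
  ext1
  rw [Closeds.coe_preimage, Closeds.coe_preimage, coe_support_vanishingIdeal]

/-- **`𝓘_{Sing X} · 𝒪_V = 𝓘_{Sing V}` along an ÉTALE `g : V ⟶ X`**: the pulled-back reduced centre is
reduced (`V(𝓘_{Sing X}) ×_X V` is étale over the reduced, locally Noetherian `V(𝓘_{Sing X})`, hence
reduced, Stacks 034E) and has support `Sing(V)`. [folklore] -/
theorem singularLocusIdeal_comap_of_etale {V X : Scheme.{u}} (f : X ⟶ Spec (.of k))
    [LocallyOfFiniteType f] (g : V ⟶ X) [Etale g] [LocallyOfFiniteType (g ≫ f)] :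
    (singularLocusIdeal X f).comap g = singularLocusIdeal V (g ≫ f) := by
  haveI : IsLocallyNoetherian X := LocallyOfFiniteType.isLocallyNoetherian f
  have hred : IsReduced ((singularLocusIdeal X f).comap g).subscheme := by
    haveI : IsReduced (singularLocusIdeal X f).subscheme := isReduced_subscheme_vanishingIdeal _
    haveI : IsLocallyNoetherian (singularLocusIdeal X f).subscheme :=
      LocallyOfFiniteType.isLocallyNoetherian (singularLocusIdeal X f).subschemeι
    haveI : Etale (pullback.snd g (singularLocusIdeal X f).subschemeι) :=
      MorphismProperty.pullback_snd _ _ inferInstance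
    haveI : IsReduced (pullback g (singularLocusIdeal X f).subschemeι) :=
      isReduced_of_smooth_of_isReduced_base (pullback.snd g (singularLocusIdeal X f).subschemeι)
    exact isReduced_of_isOpenImmersion ((singularLocusIdeal X f).comapIso g).hom
  have hrad : ((singularLocusIdeal X f).comap g).radical = (singularLocusIdeal X f).comap g :=
    (isReduced_subscheme_iff_radical_eq _).mp hred
  rw [← hrad, radical_comap_singularLocusIdeal_of_etale]

/-- **`Bl_{Sing X}(X) ×_X V = Bl_{Sing V}(V)` along an étale `g : V ⟶ X`**: the base change of a
blowing-up of the reduced singular locus is a blowing-up of the reduced singular locus of `V`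
(GW Prop. 13.91 (2) + `singularLocusIdeal_comap_of_etale`) — the étale-chart form of «the canonical
centre needs no gluing data». [folklore] -/
theorem isBlowup_pullback_snd_singularLocusIdeal_of_etale {X' X V : Scheme.{u}}
    (f : X ⟶ Spec (.of k)) [LocallyOfFiniteType f] {π : X' ⟶ X}
    (hπ : IsBlowup π (singularLocusIdeal X f)) (g : V ⟶ X) [Etale g]
    [LocallyOfFiniteType (g ≫ f)] :
    IsBlowup (pullback.snd π g) (singularLocusIdeal V (g ≫ f)) := by
  rw [← singularLocusIdeal_comap_of_etale f g]
  exact hπ.pullback_snd_of_flat g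

end Summit.ResolutionOfSingularities.ResolutionOfSingularities.Theorems.WildQuotientResolution.BlowupExit

end
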